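import Summits.BirchSwinnertonDyer.BirchSwinnertonDyer.Theorems.GenusKolyvaginAtTwoVisiblePairAtTwoCasselsTateValueTwin
import HarnessLib

/-!
# Route `CMKolyvaginAtInertTwo`, crux `CMKolyvaginExactAtInertTwo` (stmt-BirchSwinnertonDyer-24277):
# T2 input (iii) — the Cassels–Tate MEMBER FORMULA `hV₂` (McCallum Prop. 4.7 for `E^{(d_K)}` over `ℚ` at `2`)
# for an ARBITRARY SUPPORT PREDICATE `Kol ≤ kolPrime W K (2L)` and with the kill clause `2^L • t = 0`

Seat `bsd-line-cmk2-p1` g17 (cell `bsd-print-cf2`); helper (`--supports stmt-BirchSwinnertonDyer-24277`).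
THEOREMS ONLY: no definition, no named fact, no `sorry`; no item is closed; BSD is not proved by this.

T2 KIT INTERFACE REPAIR, member side (KERNEL-STATUS-p2-port.md §17; companion of
`…PairMemberHlocKolAtTwo`). Seat g16's re-based member formula `hV₂_of_localTerm_of_kill` (p706956)
quantifies over gk2's `kolPrime W K (L+L)` (depth `2L` = the carrier level) and asks the test class to
satisfy `2^{2M₀} • t = 0` with `2M₀ ≤ L` — used in its proof ONLY as `2^L • t = 0` (first-case data of
the level-`2^L` Cassels–Tate pairing inside the `2^{2L}`-carrier). The kill-clause telescope
(`card_mul_card_le_two_pow_two_mul_of_injective_of_kill`, this seat) supplies test classes with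
`2^k • t = 0` (`k` the exponent of the lift groups; take `L ≥ k`) and runs on Kolyvagin primes of depth
`2L + 1` (the level-change road `c_{2L}(n) = [2]_* c_{2L+1}(n)` to the Selmer condition at the ramified
`q ∣ d_K`, where `H¹(K_𝔮/ℚ_q, E(K_𝔮)) ≅ E(ℚ_q)[2] = ℤ/2` on `H₂`). So this file restates the member
formula with (a) ANY support predicate `Kol` implying `kolPrime W K (L+L)` (Lemma 4.3 over `ℚ` and the
displayed `hloc₂` are then asked on `Kol`-supported levels only) and (b) the clause `2^L • t = 0`,
`M₀ ≤ L`; proof VERBATIM otherwise (gk2-p2 g12's `VisiblePairAtTwo.hV₂_of_localTerm`, re-based by g16;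
credit there).

* `hV₂_of_localTerm_of_kol`.

References: [McCallumLMS1991] §2 (1), §4 Lemma 4.3, Prop. 4.7, §5 Lemma 5.3, Thm. 5.4 (proof);
[MilneADT2006] I §6 Prop. 6.9; [SerreGaloisCohomology1997] I §2.2.
-/

set_option linter.dupNamespace false -- tree convention: `Summit.BirchSwinnertonDyer.BirchSwinnertonDyer.Theorems` (summit = sub-problem)
set_option autoImplicit false

noncomputable section

open scoped Classical
open scoped AddSubgroup

universe u

namespace Summit.BirchSwinnertonDyer.BirchSwinnertonDyer.Theorems.KolyvaginPairDataTwo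

open WeierstrassCurve NumberField IsDedekindDomain Field Function Rat.HeightOneSpectrum
open Literature.NumberTheory.EllipticCurves Literature.NumberTheory.GaloisRepresentations
open Literature.NumberTheory.GaloisCohomology
open Literature.NumberTheory.GaloisRepresentations.DiscreteGaloisModule (mu)
open Literature.NumberTheory.EllipticCurves.KolyvaginDescent
open Literature.GroupTheory.FiniteAbelian
open Summit.BirchSwinnertonDyer.BirchSwinnertonDyer.Theorems.GenusExact.VisiblePairAtTwo

section MemberTwo

variable {W : WeierstrassCurve ℚ} [W.IsElliptic] [W.IsGloballyMinimal] {K : Type} [Field K] [NumberField K]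
  {L : ℕ} [(twin W K).IsElliptic]

/-- **McCallum's Prop. 4.7 for the member `E^{(d_K)}` of the `ℚ`-pair at `2`, record-free**: the value
formula `hV₂` for the pulled-back level-`2^L` Cassels–Tate pairing `P₂(z, t) = B₂(ι₂ z, ι₂ t)`,
`B₂ = ctLevelPairing (twin W K) (2^L)`, FROM the local term at `λ` (`hloc₂`, displayed). Data `c₁`, `c₂`,
`M₀`; hypotheses: `K` imaginary quadratic, `d_K` odd, `Δ < 0`, `ρ̄_{E,2}` onto, `2M₀ ≤ L`, the annihilator
`hkill : Ш(E^{(d_K)}/ℚ)[2^{2L}] ⊆ Ш(E^{(d_K)}/ℚ)[2^L]`, Lemma 4.3 over `ℚ` for `c₂`. For `n = ℓm'` of ODD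
depth, `z = 2^j c₂(ℓm') ∈ Sel_{2^M}(E^{(d_K)}/ℚ)`, `t` Selmer with `2^{2M₀} t = 0` vanishing at the primes of
`m'`: `P₂(z, t) ≠ 0`. gk2-p2 g12's `VisiblePairAtTwo.hV₂_of_localTerm` with `I : Input` replaced by what its
proof uses. [cite: McCallumLMS1991, §4 Prop. 4.7, §5 Lemma 5.3, Thm. 5.4 (proof)] [cite: MilneADT2006, Ch. I §6, Prop. 6.9] -/
theorem hV₂_of_localTerm_of_kol {M₀ : ℕ} (c₁ : ℕ → galH1Torsion W (lvl (L + L)))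
    (c₂ : ℕ → galH1Torsion (twin W K) (lvl (L + L))) (hK : IsImaginaryQuadratic K)
    (hoddK : Odd (NumberField.discr K)) (hΔ : W.Δ < 0)
    (hρ2 : W.HasSurjectiveModNGaloisRep 2) (hL : M₀ ≤ L)
    (Kol : ℕ → Prop) (hKol : ∀ ℓ, Kol ℓ → kolPrime W K (L + L) ℓ)
    -- `Ш(E^{(d_K)}/ℚ)[2^{2L}] ⊆ Ш(E^{(d_K)}/ℚ)[2^L]` (Kolyvagin's annihilator, or FINITENESS with `L` large)
    (hkill : ∀ a ∈ (twin W K).sha, ((2 : ℤ) ^ (2 * L)) • a = 0 → ((2 : ℤ) ^ L) • a = 0)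
    -- McCallum's Lemma 4.3 over `ℚ` for the classes of odd depth (finite places off the depth, infinite places)
    (loc_c₂_fin : ∀ m, KolSupp Kol m → Odd m.primeFactors.card →
      ∀ v : HeightOneSpectrum (𝓞 ℚ), (m : 𝓞 ℚ) ∉ v.asIdeal →
        c₂ m ∈ selmerLocalKer (twin W K) (v.adicCompletion ℚ) (lvl (L + L)))
    (loc_c₂_inf : ∀ m, KolSupp Kol m → Odd m.primeFactors.card →
      ∀ w : InfinitePlace ℚ, c₂ m ∈ selmerLocalKer (twin W K) w.Completion (lvl (L + L)))
    -- the Cassels–Tate data for `E^{(d_K)}` at level `2^L`, auxiliary level `2^L · 2^L`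
    (e : geomTorsion (twin W K) ((2 ^ L * 2 ^ L : ℕ) : ℤ) → geomTorsion (twin W K) ((2 ^ L * 2 ^ L : ℕ) : ℤ) →
      AlgebraicClosure ℚ)
    (hμ : ∀ S T, e S T ^ (2 ^ L * 2 ^ L) = 1)
    (hadd₁ : ∀ S₁ S₂ T, e (S₁ + S₂) T = e S₁ T * e S₂ T)
    (hadd₂ : ∀ S T₁ T₂, e S (T₁ + T₂) = e S T₁ * e S T₂)
    (hgal : ∀ (σ : absoluteGaloisGroup ℚ) (S T : geomTorsion (twin W K) ((2 ^ L * 2 ^ L : ℕ) : ℤ)),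
      σ • e S T = e (σ • S) (σ • T))
    (halt : ∀ T, e T T = 1) (inv : LocalInvariants ℚ (2 ^ L * 2 ^ L)) (hPT' : inv.SumInvLocalizationEqZero)
    (hH3 : ∀ c : galoisCohomology (mu ℚ (2 ^ L * 2 ^ L)) 3,
      (∀ v : Place ℚ, galoisCohomology.localization (mu ℚ (2 ^ L * 2 ^ L)) v 3 c = 0) → c = 0)
    (ι₂ : selmerGroup (twin W K) (lvl (L + L)) →+ ((twin W K).sha)[(2 ^ L : ℕ)])
    (hι₂ : ∀ z, shaTorsionVal (twin W K) (2 ^ L) (ι₂ z) = torsionH1ToH1 (twin W K) (lvl (L + L)) z)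
    -- McCallum's Lemma 5.3 for the local term at `λ`, in the tree's cochain currency (displayed)
    (hloc₂ : ∀ ℓ m' : ℕ, (hℓ : Kol ℓ) → KolSupp Kol (ℓ * m') → ¬ ℓ ∣ m' →
      Even m'.primeFactors.card →
      ∀ (j N a b : ℕ) (t : galH1Torsion (twin W K) (lvl (L + L))), t ∈ selmerGroup (twin W K) (lvl (L + L)) →
      ((2 : ℤ) ^ j) • c₂ (ℓ * m') ∈ selmerGroup (twin W K) (lvl (L + L)) →
      ((2 : ℤ) ^ N) • t = 0 → ((2 : ℤ) ^ L) • t = 0 →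
      (∀ q ∈ m'.primeFactors, t ∈ a₂ W K (L + L) q) → L + L - M₀ ≤ j → N + M₀ ≤ L + L → N ≤ j →
      a + b + 1 = N → ((2 : ℤ) ^ (a + (j - N))) • c₁ m' ∉ a₁ W (L + L) ℓ →
      ((2 : ℤ) ^ b) • t ∉ a₂ W K (L + L) ℓ →
      ∀ D : FirstCaseData (twin W K) (2 ^ L),
        D.b₁ = torsionH1OfDvd (twin W K) (lvl_dvd_sq L) (((2 : ℤ) ^ (j - L)) • c₂ (ℓ * m')) →
        galoisCohomology.map (inclKD (twin W K) (2 ^ L) (2 ^ L)) 1 D.b' =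
          torsionH1OfDvd (twin W K) (lvl_dvd_sq L) t →
        D.localTerm e hμ hadd₁ hadd₂ hgal inv (Sum.inr (primesEquiv.symm ⟨ℓ, (hKol ℓ hℓ).1⟩)) ≠ 0) :
    ∀ ℓ m' : ℕ, Kol ℓ → KolSupp Kol (ℓ * m') → ¬ ℓ ∣ m' →
      Even m'.primeFactors.card →
      ∀ (j N a b : ℕ) (t : galH1Torsion (twin W K) (lvl (L + L))) (ht : t ∈ selmerGroup (twin W K) (lvl (L + L)))
        (hz : ((2 : ℤ) ^ j) • c₂ (ℓ * m') ∈ selmerGroup (twin W K) (lvl (L + L))),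
      ((2 : ℤ) ^ N) • t = 0 → ((2 : ℤ) ^ L) • t = 0 →
      (∀ q ∈ m'.primeFactors, t ∈ a₂ W K (L + L) q) → L + L - M₀ ≤ j →
      N + M₀ ≤ L + L → N ≤ j → a + b + 1 = N →
      ((2 : ℤ) ^ (a + (j - N))) • c₁ m' ∉ a₁ W (L + L) ℓ →
      ((2 : ℤ) ^ b) • t ∉ a₂ W K (L + L) ℓ →
      ((ctLevelPairing (twin W K) (2 ^ L) e hμ hadd₁ hadd₂ hgal inv halt hPT' hH3
        (localTerm_finite_support (W := twin W K) (m := 2 ^ L) (e := e) (hμ := hμ) (hadd₁ := hadd₁)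
          (hadd₂ := hadd₂) (hgal := hgal) halt inv)).comp ι₂).compl₂ ι₂ ⟨_, hz⟩ ⟨t, ht⟩ ≠ 0 := by
  intro ℓ m' hℓ hsupp hndvd hodd j N a b t ht hz hN h2 hAq hj hNM hNj hab hcm hbt
  have ht2 : t ∈ selmerGroup (twin W K) (lvl (L + L)) := ht
  have hz2 : ((2 : ℤ) ^ j) • c₂ (ℓ * m') ∈ selmerGroup (twin W K) (lvl (L + L)) := hz
  have hN2 : ((2 : ℤ) ^ N) • t = 0 := hN
  have h22 : ((2 : ℤ) ^ L) • t = 0 := h2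
  have hAq2 : ∀ q ∈ m'.primeFactors, t ∈ a₂ W K (L + L) q := hAq
  have hj2 : L + L - M₀ ≤ j := hj
  have hNM2 : N + M₀ ≤ L + L := hNM
  have hcm2 : ((2 : ℤ) ^ (a + (j - N))) • c₁ m' ∉ a₁ W (L + L) ℓ := hcm
  have hbt2 : ((2 : ℤ) ^ b) • t ∉ a₂ W K (L + L) ℓ := hbt
  have hℓp : ℓ.Prime := (hKol ℓ hℓ).1
  haveI : NeZero (2 ^ L) := ⟨pow_ne_zero L two_ne_zero⟩
  have hΔ : W.Δ < 0 := hΔ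
  have hjL : L ≤ j := by omega
  have hodd' : Odd (ℓ * m').primeFactors.card := by
    have hmem : ℓ ∈ (ℓ * m').primeFactors :=
      Nat.mem_primeFactors.mpr ⟨hℓp, dvd_mul_right ℓ m', hsupp.1.ne_zero⟩
    obtain ⟨-, -, -, -, -, -, -, hcard⟩ := kolSupp_div hsupp hmem
    rw [Nat.mul_div_cancel_left m' hℓp.pos] at hcard
    rw [← hcard]; exact hodd.add_one
  set v₀ : HeightOneSpectrum (𝓞 ℚ) := primesEquiv.symm ⟨ℓ, hℓp⟩ with hv₀
  -- unfold the pulled-back pairing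
  change ctLevelPairing (twin W K) (2 ^ L) e hμ hadd₁ hadd₂ hgal inv halt hPT' hH3
    (localTerm_finite_support (W := twin W K) (m := 2 ^ L) (e := e) (hμ := hμ) (hadd₁ := hadd₁) (hadd₂ := hadd₂)
      (hgal := hgal) halt inv) (ι₂ ⟨_, hz⟩) (ι₂ ⟨t, ht⟩) ≠ 0
  -- the map `ι'` at level `2^L · 2^L`
  have hsha : ∀ c ∈ (twin W K).sha, ((2 : ℤ) ^ (2 * L)) • c = 0 → ((2 : ℤ) ^ L) • c = 0 :=
    hkill
  have hL' : ∀ c ∈ (twin W K).sha, (((2 ^ L * 2 ^ L : ℕ) : ℤ)) • c = 0 → ((2 ^ L : ℕ) : ℤ) • c = 0 := by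
    intro c hc h0
    rw [Nat.cast_pow, Nat.cast_ofNat]
    refine hsha c hc ?_
    rwa [Nat.cast_mul, Nat.cast_pow, Nat.cast_ofNat, ← pow_add, ← two_mul] at h0
  obtain ⟨ι', hι'⟩ := exists_selmerToShaTorsion (twin W K) (2 ^ L) hL'
  -- transport to the level `2^L · 2^L`
  have hzτ : torsionH1OfDvd (twin W K) (lvl_dvd_sq L) (((2 : ℤ) ^ j) • c₂ (ℓ * m')) ∈
      selmerGroup (twin W K) ((2 ^ L * 2 ^ L : ℕ) : ℤ) := torsionH1OfDvd_mem_selmerGroup (twin W K) _ hz2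
  have htτ : torsionH1OfDvd (twin W K) (lvl_dvd_sq L) t ∈ selmerGroup (twin W K) ((2 ^ L * 2 ^ L : ℕ) : ℤ) :=
    torsionH1OfDvd_mem_selmerGroup (twin W K) _ ht2
  have hιz : ι₂ ⟨_, hz⟩ = ι' ⟨torsionH1OfDvd (twin W K) (lvl_dvd_sq L) (((2 : ℤ) ^ j) • c₂ (ℓ * m')), hzτ⟩ :=
    Subtype.ext (Subtype.ext (by
      change shaTorsionVal (twin W K) (2 ^ L) (ι₂ ⟨_, hz⟩) = shaTorsionVal (twin W K) (2 ^ L) (ι' ⟨_, hzτ⟩)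
      rw [hι₂, hι', torsionH1ToH1_torsionH1OfDvd]))
  have hιt : ι₂ ⟨t, ht⟩ = ι' ⟨torsionH1OfDvd (twin W K) (lvl_dvd_sq L) t, htτ⟩ :=
    Subtype.ext (Subtype.ext (by
      change shaTorsionVal (twin W K) (2 ^ L) (ι₂ ⟨t, ht⟩) = shaTorsionVal (twin W K) (2 ^ L) (ι' ⟨_, htτ⟩)
      rw [hι₂, hι', torsionH1ToH1_torsionH1OfDvd]))
  rw [hιz, hιt]
  -- `z' = 2^L • b₁`
  have hz' : ((⟨torsionH1OfDvd (twin W K) (lvl_dvd_sq L) (((2 : ℤ) ^ j) • c₂ (ℓ * m')), hzτ⟩ :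
      selmerGroup (twin W K) ((2 ^ L * 2 ^ L : ℕ) : ℤ)) : galH1Torsion (twin W K) ((2 ^ L * 2 ^ L : ℕ) : ℤ)) =
      ((2 ^ L : ℕ) : ℤ) • torsionH1OfDvd (twin W K) (lvl_dvd_sq L) (((2 : ℤ) ^ (j - L)) • c₂ (ℓ * m')) := by
    change torsionH1OfDvd (twin W K) (lvl_dvd_sq L) (((2 : ℤ) ^ j) • c₂ (ℓ * m')) = _
    rw [← map_zsmul, zsmul_pow_sub_eq hjL]
  -- first-case data: `[2^L]_* t' = 0` (`2^L t = 0` displayed, `E(ℚ) ∩ E[2^L] = 0`)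
  have hd : ((NumberField.discr K : ℤ) : ℚ) ≠ 0 := by exact_mod_cast NumberField.discr_ne_zero K
  have hρ2' : (twin W K).HasSurjectiveModNGaloisRep 2 :=
    (hasSurjectiveModNGaloisRep_two_quadraticTwist_iff W hd).mpr hρ2
  have h2W := DokchitserDokchitser2012.forall_two_nsmul_of_hasSurjectiveModNGaloisRep_two (twin W K)
    two_ne_zero hρ2'
  have hfix : ∀ P : geomTorsion (twin W K) ((2 ^ L : ℕ) : ℤ),
      (∀ σ : absoluteGaloisGroup ℚ, σ • P = P) → P = 0 :=
    geomTorsion_fixed_eq_zero_of_forall_two_nsmul (twin W K) h2W L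
  have h2L : ((2 ^ L : ℕ) : ℤ) • t = 0 := by
    rw [Nat.cast_pow, Nat.cast_ofNat]
    exact h22
  have hmt : ((2 ^ L : ℕ) : ℤ) • torsionH1OfDvd (twin W K) (lvl_dvd_sq L) t = 0 := by
    rw [← map_zsmul, h2L, map_zero]
  have hb₁ : ((2 ^ L : ℕ) : ℤ) • torsionH1OfDvd (twin W K) (lvl_dvd_sq L) (((2 : ℤ) ^ (j - L)) • c₂ (ℓ * m')) ∈
      selmerGroup (twin W K) ((2 ^ L * 2 ^ L : ℕ) : ℤ) := by
    rw [← map_zsmul, zsmul_pow_sub_eq hjL]; exact hzτ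
  obtain ⟨D, hD₁, hDt⟩ := exists_firstCaseData_of_zsmul_of_map_mulK_eq_zero (twin W K) (2 ^ L) hb₁ htτ
    (map_mulK_eq_zero_of_zsmul_eq_zero (twin W K) (2 ^ L) hfix hmt)
  rw [ctLevelPairing_pullback_ne_zero_iff_localTerm e hμ hadd₁ hadd₂ hgal inv halt hPT' hH3 _ ι' hι'
    ⟨_, hzτ⟩ ⟨_, htτ⟩ hz' D hD₁ hDt (Sum.inr v₀) ?_]
  · exact hloc₂ ℓ m' hℓ hsupp hndvd hodd j N a b t ht2 hz2 hN2 h22 hAq2 hj2 hNM2 hNj hab hcm2 hbt2 D hD₁ hDt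
  -- ### the places `v ≠ v_ℓ`
  intro v hv
  rcases v with w | v'
  · -- an infinite place: Lemma 4.3 at `∞`
    left
    have hc : c₂ (ℓ * m') ∈ selmerLocalKer (twin W K) (Place.Completion (Sum.inl w : Place ℚ)) (lvl (L + L)) :=
      loc_c₂_inf (ℓ * m') hsupp hodd' w
    have hc' := (torsionH1OfDvd_mem_selmerLocalKer_iff (twin W K) (Place.Completion (Sum.inl w : Place ℚ))
      (lvl_dvd_sq L) _).mp hc
    have key := mem_kummerLocalConditionAt_res_of_mem_selmerLocalKer (twin W K) _ _ hc'
    rw [map_zsmul]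
    convert AddSubgroup.zsmul_mem _ key ((2 : ℤ) ^ (j - L)) using 1
    exact map_zsmul _ _ _
  · by_cases hdiv : ((ℓ * m' : ℕ) : 𝓞 ℚ) ∈ v'.asIdeal
    · -- a place of `ℓ m'` other than `v_ℓ`: a place `v_q`, `q ∣ m'`
      right
      have hm' : ((m' : ℕ) : 𝓞 ℚ) ∈ v'.asIdeal := by
        rcases natCast_mem_or_natCast_mem_of_mul_mem hdiv with h1 | h1
        · exact absurd ((natCast_prime_mem_iff_eq hℓp v').mp h1) (fun h ↦ hv (by rw [h]))
        · exact h1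
      -- a prime factor `q` of `m'` with `q ∈ v'`
      obtain ⟨hsqm', hkolm'⟩ : KolSupp Kol m' := by
        have hmem : ℓ ∈ (ℓ * m').primeFactors :=
          Nat.mem_primeFactors.mpr ⟨hℓp, dvd_mul_right ℓ m', hsupp.1.ne_zero⟩
        obtain ⟨h, -⟩ := kolSupp_div hsupp hmem
        rwa [Nat.mul_div_cancel_left m' hℓp.pos] at h
      haveI := v'.isPrime
      have hprod : ((∏ q ∈ m'.primeFactors, q : ℕ) : 𝓞 ℚ) ∈ v'.asIdeal := by
        rwa [Nat.prod_primeFactors_of_squarefree hsqm']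
      rw [Nat.cast_prod] at hprod
      obtain ⟨q, hq, hqv⟩ := Ideal.IsPrime.prod_mem_iff.mp hprod
      have hqp : q.Prime := Nat.prime_of_mem_primeFactors hq
      have hkq : kolPrime W K (L + L) q := hKol q (hkolm' q hq)
      have hv'eq : v' = primesEquiv.symm ⟨q, hqp⟩ := (natCast_prime_mem_iff_eq hqp v').mp hqv
      subst hv'eq
      refine ⟨?_, map_inclKD_restrictField_injective_twin_of_kolPrime hK hoddK hΔ hkq⟩
      -- `loc_q t' = 0`
      have htq : t ∈ (twin W K).torsionLocalKer
          ((primesEquiv.symm ⟨q, hqp⟩ : HeightOneSpectrum (𝓞 ℚ)).adicCompletion ℚ) (lvl (L + L)) :=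
        (mem_a₂_iff hqp t).mp (hAq2 q hq)
      have htq' := torsionH1OfDvd_mem_torsionLocalKer (twin W K)
        (Place.Completion (Sum.inr (primesEquiv.symm ⟨q, hqp⟩) : Place ℚ)) (lvl_dvd_sq L) htq
      -- (`CharZero ℚ_q` passed explicitly: as an instance it would let `DivisionRing.toRatAlgebra` compete with
      -- `Place.instAlgebraCompletion`)
      exact (@mem_torsionLocalKer_iff_res_eq_zero ℚ _ (twin W K)
        (Place.Completion (Sum.inr (primesEquiv.symm ⟨q, hqp⟩) : Place ℚ)) _ (Place.instAlgebraCompletion _) _ _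
        (charZero_placeCompletion _) (2 ^ L * 2 ^ L) (NeZero.ne (2 ^ L * 2 ^ L)) _).mp htq'
    · -- a finite place not dividing `ℓ m'`: Lemma 4.3 over `ℚ`
      left
      have hc : c₂ (ℓ * m') ∈ selmerLocalKer (twin W K) (Place.Completion (Sum.inr v' : Place ℚ))
          (lvl (L + L)) := loc_c₂_fin (ℓ * m') hsupp hodd' v' hdiv
      have hc' := (torsionH1OfDvd_mem_selmerLocalKer_iff (twin W K) (Place.Completion (Sum.inr v' : Place ℚ))
        (lvl_dvd_sq L) _).mp hc
      have key := mem_kummerLocalConditionAt_res_of_mem_selmerLocalKer (twin W K) _ _ hc'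
      rw [map_zsmul]
      convert AddSubgroup.zsmul_mem _ key ((2 : ℤ) ^ (j - L)) using 1
      exact map_zsmul _ _ _

end MemberTwo

end Summit.BirchSwinnertonDyer.BirchSwinnertonDyer.Theorems.KolyvaginPairDataTwo

end
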